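import Mathlib.Topology.MetricSpace.Basic
import Mathlib.Topology.Connected.Basic
import HarnessLib

/-!
# Route PhotonSphereChannels · crux `ChannelsResolveTameDevelopmentsR` (K2R-T2, stmt-FinalStateConjecture-17430) —
# the ∀→∃ conversion of stub K `stub_kerrLocusClopen` (line `dark-future-exactness`) on an abstract preconnected hull:
# an isolated, relatively closed, PINNED locus that is met is the whole hull

Stub K of the skeleton `Cruxes/ChannelsResolveTameDevelopmentsR/Lines/dark_future_exactness.lean` converts ONE exactly-Kerr
horizon-hull element along a horizon generator path `γ` into "ALL horizon-hull elements along `γ` are Kerr with one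
sub-extremal `(M, a)`". Its intended proof is point-set topology on the based hull `Ω_γ` plus three geometric inputs
(docstring of `KerrLocusClopen`): `Ω_γ` is (compact and) CONNECTED; the Kerr locus at fixed parameters is CLOSED; it is
OPEN because (i) elements near a Kerr-`(M, a)` element contain exterior windows close to Kerr `(M, a)` ("closeness sets are
neighbourhoods of the locus"), (ii) WINDOW ISOLATION returns exact Kerr with `ε`-near parameters, and (iii) PINNING (area
theorem / mass budget) leaves only finitely many admissible parameter values, so `ε`-near means equal.

This file proves exactly that conversion with the hull, the loci, the closeness sets and the parameter space ABSTRACT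
(a preconnected subset `Ω` of a topological space `H`, a family `locus p ⊆ H` indexed by a pseudo-metric parameter space
`P` with an admissibility predicate `Adm`, closeness sets `close p i ⊆ H` indexed by window sizes `i : I`), so that the
geometric inputs of K enter as the four named hypotheses and nothing else:

* `subset_locus_of_isolatedParameter` — core form: relative closedness of `locus p₀ ∩ Ω` in `Ω`, closeness sets of `p₀`
  are `𝓝[Ω]`-neighbourhoods of `locus p₀ ∩ Ω`, isolation at `p₀` (`∀ ε > 0 ∃ i`, every element of `Ω` in `close p₀ i` lies in
  an admissible locus `ε`-near `p₀`), and `p₀` ISOLATED among the parameters realised on `Ω` (`∃ ε > 0`, admissible `p'`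
  with `dist p' p₀ ≤ ε` have `locus p' ∩ Ω ⊆ locus p₀`) give `Ω ⊆ locus p₀` as soon as `locus p₀` meets `Ω`;
* `subset_locus_of_finitePinning` — the same with isolatedness derived from PINNING: the admissible parameters realised on
  `Ω` lie in a finite set (metric parameter space);
* `exists_forall_mem_locus_of_finitePinning` — the quantifier shape of K's conclusion: if SOME element of `Ω` lies in SOME
  admissible locus then ONE admissible parameter serves ALL of `Ω`.

The connectedness step is the use of connectedness of limit sets in Hale 1980, Ch. I §8 (cf. the landed
`HullTopology.subset_or_disjoint_of_isPreconnected`, `…RHullDichotomy.lean`, which is the one-locus dichotomy WITHOUT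
parameters); the new content here is the parameter bookkeeping (isolation returns only `ε`-near parameters; pinning makes
them equal), i.e. the "∀→∃" half of K. What is NOT here: the topology on horizon-hull elements, its connectedness, the
closedness of Kerr loci, the neighbourhood property of exterior-window closeness and the pinning budget — the four inputs K
still owes (lead's `work/stubs/stub_kerrLocusClopen.md`).

References: Hale 1980, Ch. I §8, Lemma 8.1 / Thm. 8.1 (limit sets of precompact orbits are connected; a connected set meeting
an open-and-closed set lies in it) [Hale1980]; Walters 1982, §5.2 [Walters1982].
-/

-- every `Summit.FinalStateConjecture.FinalStateConjecture.…` name repeats the summit = sub-problem segment (D-0017 layout)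
set_option linter.dupNamespace false

open Set Filter Topology

namespace Summit.FinalStateConjecture.FinalStateConjecture.Theorems.HullTopology

variable {H P I : Type*} [TopologicalSpace H]

/-! ### §1 Core: an isolated parameter whose locus is relatively closed, has closeness neighbourhoods, and is met -/

/-- **The ∀→∃ conversion on a preconnected hull, core form.** Let `Ω ⊆ H` be preconnected, `locus : P → Set H` a family of
loci over a pseudo-metric parameter space with admissibility predicate `Adm`, and `close p i ⊆ H` closeness sets. Fix `p₀`.
Assume: (closed) `locus p₀ ∩ Ω` is relatively closed in `Ω`; (nhds) every closeness set of `p₀` is a neighbourhood within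
`Ω` of every point of `locus p₀ ∩ Ω`; (iso) for every `ε > 0` some closeness set of `p₀` consists, on `Ω`, of points lying
in admissible loci `ε`-near `p₀`; (isolated) for some `ε > 0`, admissible parameters `ε`-near `p₀` have their locus on `Ω`
inside `locus p₀`. If `locus p₀` meets `Ω`, then `Ω ⊆ locus p₀`. Proof: (nhds)+(iso)+(isolated) make `locus p₀ ∩ Ω`
relatively open, (closed) makes it relatively closed, and a preconnected set meeting a relatively clopen set lies in it
(Hale 1980, Ch. I §8). [cite: Hale1980, Ch. I §8, Lemma 8.1] -/
theorem subset_locus_of_isolatedParameter [PseudoMetricSpace P] {Ω : Set H} (hΩ : IsPreconnected Ω)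
    (Adm : P → Prop) (locus : P → Set H) (close : P → I → Set H) (p₀ : P)
    (hclosed : ∀ z ∈ Ω, z ∈ closure (locus p₀ ∩ Ω) → z ∈ locus p₀)
    (hnhds : ∀ i, ∀ z ∈ locus p₀ ∩ Ω, close p₀ i ∈ 𝓝[Ω] z)
    (hiso : ∀ ε > (0 : ℝ), ∃ i, ∀ z ∈ Ω, z ∈ close p₀ i → ∃ p', Adm p' ∧ dist p' p₀ ≤ ε ∧ z ∈ locus p')
    (hisol : ∃ ε > (0 : ℝ), ∀ p', Adm p' → dist p' p₀ ≤ ε → locus p' ∩ Ω ⊆ locus p₀)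
    (hne : (locus p₀ ∩ Ω).Nonempty) : Ω ⊆ locus p₀ := by
  classical
  -- the relatively open side: an open `u ⊇ locus p₀ ∩ Ω` with `u ∩ Ω ⊆ locus p₀`
  obtain ⟨ε, hε, hpin⟩ := hisol
  obtain ⟨i, hi⟩ := hiso ε hε
  have hopen : ∀ z ∈ locus p₀ ∩ Ω, ∃ u : Set H, IsOpen u ∧ z ∈ u ∧ u ∩ Ω ⊆ locus p₀ := by
    intro z hz
    obtain ⟨u, hu, hzu, huΩ⟩ := mem_nhdsWithin.1 (hnhds i z hz)
    refine ⟨u, hu, hzu, fun w hw ↦ ?_⟩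
    obtain ⟨p', hp', hdist, hwp'⟩ := hi w hw.2 (huΩ hw)
    exact hpin p' hp' hdist ⟨hwp', hw.2⟩
  choose! u hu using hopen
  set U : Set H := ⋃ z ∈ locus p₀ ∩ Ω, u z with hU
  have hUo : IsOpen U := isOpen_biUnion fun z hz ↦ (hu z hz).1
  have hUΩ : U ∩ Ω ⊆ locus p₀ := by
    rintro w ⟨hwU, hwΩ⟩
    obtain ⟨z, hz, hwz⟩ := mem_iUnion₂.1 hwU
    exact (hu z hz).2.2 ⟨hwz, hwΩ⟩
  have hSU : locus p₀ ∩ Ω ⊆ U := fun z hz ↦ mem_iUnion₂.2 ⟨z, hz, (hu z hz).2.1⟩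
  -- the relatively closed side: the open complement of the closure misses `locus p₀ ∩ Ω` and covers `Ω ∖ locus p₀`
  set V : Set H := (closure (locus p₀ ∩ Ω))ᶜ with hV
  have hVo : IsOpen V := isClosed_closure.isOpen_compl
  have hcover : Ω ⊆ U ∪ V := by
    intro z hz
    by_cases h : z ∈ locus p₀
    · exact Or.inl (hSU ⟨h, hz⟩)
    · exact Or.inr fun hcl ↦ h (hclosed z hz hcl)
  -- preconnectedness: `Ω` cannot meet both
  intro z hz
  by_contra hzl
  have hzV : z ∈ V := fun hcl ↦ hzl (hclosed z hz hcl)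
  obtain ⟨z₀, hz₀⟩ := hne
  obtain ⟨w, hwΩ, hwU, hwV⟩ := hΩ U V hUo hVo hcover ⟨z₀, hz₀.2, hSU hz₀⟩ ⟨z, hz, hzV⟩
  exact hwV (subset_closure ⟨hUΩ ⟨hwU, hwΩ⟩, hwΩ⟩)

/-! ### §2 Pinning: finitely many realised admissible parameters isolate each of them -/

omit [TopologicalSpace H] in
/-- **Finitely many realised parameters are isolated**: in a metric parameter space, if the admissible parameters whose locus
meets `Ω` lie in a finite set `F`, then for every `p₀` there is `ε > 0` such that every admissible `p'` with `dist p' p₀ ≤ ε`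
whose locus meets `Ω` equals `p₀`. (Pure bookkeeping: `ε` below the least positive distance from `p₀` to `F`.) [folklore] -/
theorem exists_isolating_radius_of_finite [MetricSpace P] {Ω : Set H} (Adm : P → Prop) (locus : P → Set H)
    {F : Set P} (hF : F.Finite) (hpin : ∀ p', Adm p' → (locus p' ∩ Ω).Nonempty → p' ∈ F) (p₀ : P) :
    ∃ ε > (0 : ℝ), ∀ p', Adm p' → (locus p' ∩ Ω).Nonempty → dist p' p₀ ≤ ε → p' = p₀ := by
  -- for each of the finitely many `q ∈ F` other than `p₀`, small radii avoid `q`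
  have hev : ∀ᶠ ε in 𝓝[>] (0 : ℝ), ∀ q ∈ F, q ≠ p₀ → ε < dist q p₀ := by
    refine (hF.eventually_all (l := 𝓝[>] (0 : ℝ)) (p := fun q ε ↦ q ≠ p₀ → ε < dist q p₀)).2 fun q _ ↦ ?_
    by_cases hq : q = p₀
    · exact Eventually.of_forall fun _ h ↦ absurd hq h
    · have hpos : 0 < dist q p₀ := dist_pos.2 hq
      exact (eventually_lt_nhds hpos).filter_mono nhdsWithin_le_nhds |>.mono fun _ h _ ↦ h
  obtain ⟨ε, hεF, hεpos⟩ := (hev.and self_mem_nhdsWithin).exists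
  refine ⟨ε, hεpos, fun p' hp' hne hdist ↦ ?_⟩
  by_contra hne'
  exact absurd hdist (not_le_of_gt (hεF p' (hpin p' hp' hne) hne'))

/-- **The ∀→∃ conversion under finite pinning.** As `subset_locus_of_isolatedParameter`, with the isolatedness of `p₀`
replaced by PINNING: the admissible parameters realised on `Ω` lie in a finite set (metric parameter space), and `p₀`
admissible. This is the abstract form of stub K `stub_kerrLocusClopen`: `Ω` = the horizon-hull elements along a generator
path (connected), `locus (M, a)` = elements with d.o.c. exactly Kerr `(M, a)` (closed at fixed parameters), `close (M, a)
(W, η, δ)` = elements containing an exterior window `(W, η, δ)`-close to Kerr `(M, a)` (a neighbourhood of the locus),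
`Adm` = sub-extremality, (iso) = window isolation along generators, pinning = area theorem and mass budget.
[cite: Hale1980, Ch. I §8, Lemma 8.1] -/
theorem subset_locus_of_finitePinning [MetricSpace P] {Ω : Set H} (hΩ : IsPreconnected Ω)
    (Adm : P → Prop) (locus : P → Set H) (close : P → I → Set H) (p₀ : P) (hp₀ : Adm p₀)
    (hclosed : ∀ z ∈ Ω, z ∈ closure (locus p₀ ∩ Ω) → z ∈ locus p₀)
    (hnhds : ∀ i, ∀ z ∈ locus p₀ ∩ Ω, close p₀ i ∈ 𝓝[Ω] z)
    (hiso : ∀ ε > (0 : ℝ), ∃ i, ∀ z ∈ Ω, z ∈ close p₀ i → ∃ p', Adm p' ∧ dist p' p₀ ≤ ε ∧ z ∈ locus p')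
    (hpin : ∃ F : Set P, F.Finite ∧ ∀ p', Adm p' → (locus p' ∩ Ω).Nonempty → p' ∈ F)
    (hne : (locus p₀ ∩ Ω).Nonempty) : Ω ⊆ locus p₀ := by
  obtain ⟨F, hF, hpinF⟩ := hpin
  obtain ⟨ε, hε, hisol⟩ := exists_isolating_radius_of_finite Adm locus hF hpinF p₀
  refine subset_locus_of_isolatedParameter hΩ Adm locus close p₀ hclosed hnhds hiso ⟨ε, hε, ?_⟩ hne
  intro p' hp' hdist z hz
  have h := hisol p' hp' ⟨z, hz⟩ hdist
  subst h
  exact hz.1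

/-- **K's quantifier shape: one witness in some admissible locus ⇒ one admissible parameter for the whole hull.** Under
the hypotheses of `subset_locus_of_finitePinning` imposed at EVERY admissible parameter (relative closedness of each
admissible locus, closeness neighbourhoods, isolation) and finite pinning, if some element of the preconnected hull `Ω`
lies in some admissible locus, then there is ONE admissible parameter whose locus contains all of `Ω` — the conversion
"`∃` exactly-Kerr horizon-hull element along `γ` ⇒ `∃ (M, a)`, ALL horizon-hull elements along `γ` are Kerr `(M, a)`" of
stub K, with its geometric inputs as hypotheses. [cite: Hale1980, Ch. I §8, Lemma 8.1] -/
theorem exists_forall_mem_locus_of_finitePinning [MetricSpace P] {Ω : Set H} (hΩ : IsPreconnected Ω)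
    (Adm : P → Prop) (locus : P → Set H) (close : P → I → Set H)
    (hclosed : ∀ p, Adm p → ∀ z ∈ Ω, z ∈ closure (locus p ∩ Ω) → z ∈ locus p)
    (hnhds : ∀ p, Adm p → ∀ i, ∀ z ∈ locus p ∩ Ω, close p i ∈ 𝓝[Ω] z)
    (hiso : ∀ p, Adm p → ∀ ε > (0 : ℝ), ∃ i, ∀ z ∈ Ω, z ∈ close p i →
      ∃ p', Adm p' ∧ dist p' p ≤ ε ∧ z ∈ locus p')
    (hpin : ∃ F : Set P, F.Finite ∧ ∀ p', Adm p' → (locus p' ∩ Ω).Nonempty → p' ∈ F)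
    (hwit : ∃ z ∈ Ω, ∃ p, Adm p ∧ z ∈ locus p) : ∃ p, Adm p ∧ ∀ z ∈ Ω, z ∈ locus p := by
  obtain ⟨z, hz, p, hp, hzp⟩ := hwit
  exact ⟨p, hp, fun w hw ↦ subset_locus_of_finitePinning hΩ Adm locus close p hp (hclosed p hp) (hnhds p hp)
    (hiso p hp) hpin ⟨z, hzp, hz⟩ hw⟩

/-! ### §3 Registered sub-goal of stub K (one-line closed form of `exists_forall_mem_locus_of_finitePinning`) -/

/-- **Registered sub-goal `kerrLocusClopen_pinnedClopen_abstract` of stub K `stub_kerrLocusClopen`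
(stmt-FinalStateConjecture-17430, line `dark-future-exactness`)**: the ∀→∃ conversion of K with its four geometric inputs
(hull topology preconnected; admissible loci relatively closed; closeness sets neighbourhoods of the loci; isolation returns
`ε`-near admissible parameters) and finite pinning as hypotheses — `exists_forall_mem_locus_of_finitePinning`, fully
quantified. [cite: Hale1980, Ch. I §8, Lemma 8.1] -/
theorem kerrLocusClopen_pinnedClopen_abstract : ∀ {H P I : Type*} [TopologicalSpace H] [MetricSpace P] {Ω : Set H}, IsPreconnected Ω → ∀ (Adm : P → Prop) (locus : P → Set H) (close : P → I → Set H), (∀ p, Adm p → ∀ z ∈ Ω, z ∈ closure (locus p ∩ Ω) → z ∈ locus p) → (∀ p, Adm p → ∀ i, ∀ z ∈ locus p ∩ Ω, close p i ∈ 𝓝[Ω] z) → (∀ p, Adm p → ∀ ε > (0 : ℝ), ∃ i, ∀ z ∈ Ω, z ∈ close p i → ∃ p', Adm p' ∧ dist p' p ≤ ε ∧ z ∈ locus p') → (∃ F : Set P, F.Finite ∧ ∀ p', Adm p' → (locus p' ∩ Ω).Nonempty → p' ∈ F) → (∃ z ∈ Ω, ∃ p, Adm p ∧ z ∈ locus p)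 → ∃ p, Adm p ∧ ∀ z ∈ Ω, z ∈ locus p :=
  fun hΩ Adm locus close hclosed hnhds hiso hpin hwit ↦
    exists_forall_mem_locus_of_finitePinning hΩ Adm locus close hclosed hnhds hiso hpin hwit

end Summit.FinalStateConjecture.FinalStateConjecture.Theorems.HullTopology
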